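import Mathlib
import Literature.Computability.AlgebraicComplexity.HessianAtOrigin
import Literature.Computability.AlgebraicComplexity.HessianRank
import Summits.ValiantsHypothesis.ValiantsHypothesis.Theorems.GrenetZeonTwoDimCoefficientsSlotAccounting

/-!
# Crux `GrenetZeon.TwoDimCoefficients` (stmt-ValiantsHypothesis-8062) / rung `DualUnipotentThreeHalves` (stmt-24318):
# slot accounting in rank language — the rank of a matrix is at most the sum of the ranks of its row blocks

Companion of `…GrenetZeonTwoDimCoefficientsSlotAccounting.lean` (memo TWENTY-FIRST HAND, Theorems T1/T2).  There the
accounting step is phrased for linear maps into a product (`finrank_range_pi_le`); the Hessian `hess0 (transl z f)`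
of the tree is a MATRIX indexed by the variables, so the form actually consumed is: partition the variables into
slots by `grp : σ → ι`; then `rank (hess0 …) ≤ Σ_slots rank (row block of the slot)`.

* `rank_sum_le` — `rank (Σ_i A_i) ≤ Σ_i rank A_i`;
* ★ `rank_le_sum_rank_rowBlocks` — `rank M ≤ Σ_i rank (M restricted to the rows of fibre i)` for any `grp : σ → ι`;
* `rank_hess0_le_sum_rank_rowBlocks` — the same, stated for `hess0 (transl z f)`.

Pure linear algebra; no permanent.  HONEST FRAMING: a brick; the stub `DualUnipotentBound`, the 24318 decl and
`VP ≠ VNP` remain open.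

References: folklore linear algebra.
-/

set_option linter.dupNamespace false
set_option autoImplicit false

namespace Summit.ValiantsHypothesis.ValiantsHypothesis.Theorems.GrenetZeonTwoDimCoefficients.SlotAccounting

open Module
open Literature.Computability.AlgebraicComplexity (rank_add_le hess0 transl)

variable {K : Type*} [Field K] {σ τ : Type*} [Fintype σ] [Fintype τ] [DecidableEq σ]

omit [DecidableEq σ] in
/-- Subadditivity of the rank over a finite sum. [folklore] -/
theorem rank_sum_le {ι : Type*} (s : Finset ι) (A : ι → Matrix σ τ K) :
    (∑ i ∈ s, A i).rank ≤ ∑ i ∈ s, (A i).rank := by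
  classical
  induction s using Finset.induction_on with
  | empty => simp
  | insert a s ha ih =>
    rw [Finset.sum_insert ha, Finset.sum_insert ha]
    exact (rank_add_le _ _).trans (by omega)

/-- ★ **Row-block accounting.**  For any labelling `grp : σ → ι` of the rows, the rank of `M` is at most the sum
over the labels of the ranks of the row blocks `M|_{grp = i}`. [folklore] -/
theorem rank_le_sum_rank_rowBlocks {ι : Type*} [Fintype ι] [DecidableEq ι] (M : Matrix σ τ K) (grp : σ → ι) :
    M.rank ≤ ∑ i, (M.submatrix (Subtype.val : {s : σ // grp s = i} → σ) id).rank := by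
  classical
  -- the inclusion matrices of the fibres
  let E : ∀ i : ι, Matrix σ {s : σ // grp s = i} K := fun i s x => if s = x.1 then 1 else 0
  -- `M` is the sum of its row blocks pushed back by the inclusions
  have hM : M = ∑ i, E i * M.submatrix (Subtype.val : {s : σ // grp s = i} → σ) id := by
    ext s t
    rw [Matrix.sum_apply]
    have hterm : ∀ i, (E i * M.submatrix (Subtype.val : {s : σ // grp s = i} → σ) id) s t =
        if grp s = i then M s t else 0 := by
      intro i
      rw [Matrix.mul_apply]
      split_ifs with hi
      · rw [Finset.sum_eq_single ⟨s, hi⟩]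
        · simp [E]
        · intro x _ hx
          have : s ≠ x.1 := fun h => hx (Subtype.ext h.symm)
          simp [E, this]
        · intro h; exact absurd (Finset.mem_univ _) h
      · apply Finset.sum_eq_zero
        intro x _
        have : s ≠ x.1 := fun h => hi (h ▸ x.2)
        simp [E, this]
    simp_rw [hterm]
    rw [Finset.sum_ite_eq Finset.univ (grp s) (fun _ => M s t)]
    simp
  calc M.rank = (∑ i, E i * M.submatrix (Subtype.val : {s : σ // grp s = i} → σ) id).rank := by rw [← hM]
    _ ≤ ∑ i, (E i * M.submatrix (Subtype.val : {s : σ // grp s = i} → σ) id).rank := rank_sum_le _ _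
    _ ≤ ∑ i, (M.submatrix (Subtype.val : {s : σ // grp s = i} → σ) id).rank :=
        Finset.sum_le_sum fun i _ => Matrix.rank_mul_le_right _ _

/-- The accounting step for the Hessian at a point: with the variables labelled by slots via `grp`,
`rank Hess_z f ≤ Σ_slots rank (row block of the slot)`. [folklore] -/
theorem rank_hess0_le_sum_rank_rowBlocks {ι : Type*} [Fintype ι] [DecidableEq ι]
    (f : MvPolynomial σ K) (z : σ → K) (grp : σ → ι) :
    (hess0 (transl z f)).rank ≤
      ∑ i, ((hess0 (transl z f)).submatrix (Subtype.val : {s : σ // grp s = i} → σ) id).rank :=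
  rank_le_sum_rank_rowBlocks _ grp


/-! ## Glue: a row block of a (Hessian) matrix, reshaped as a slot map, inherits the slot rate (append, same hand)

For slot `t` with block coordinates `e : {s // grp s = t} ≃ a × b` the row block of `H` is the matrix of the linear
map `y ↦ (H·y)|_t`, reshaped to `a × b` matrices; if that reshaped map is a pivot slot map
(`finrank_range_le_slotRate_of_pivot`), the row block has rank `≤ μ(|a| + |b|) − μ²`.  With
`rank_hess0_le_sum_rank_rowBlocks` this is the complete abstract form of Theorem T1: what remains per polynomial is
to compute `(hess0 (transl z f))·y` blockwise. -/

omit [DecidableEq σ] in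
/-- ★ **Row block as slot map.**  If, in block coordinates `e`, the slot-`t` part of `H·y` equals
`Σ_σ A_σ·L_σ(y)·B_σ` with every term factoring through a common `P : a × r₀` or `Q : r₁ × b` (`|r₀|, |r₁| ≤ μ ≤ |a|, |b|`),
then the row block of `H` at slot `t` has rank `≤ μ·(|a| + |b|) − μ²`. [folklore] -/
theorem rank_rowBlock_le_slotRate {ι : Type*} [DecidableEq ι] (H : Matrix σ σ K) (grp : σ → ι) (t : ι)
    {a b : Type*} [Fintype a] [Fintype b] (e : {s : σ // grp s = t} ≃ a × b)
    (μ : ℕ) (ha : μ ≤ Fintype.card a) (hb : μ ≤ Fintype.card b)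
    {r₀ r₁ : Type*} [Fintype r₀] [Fintype r₁] (P : Matrix a r₀ K) (Q : Matrix r₁ b K)
    (hP : Fintype.card r₀ ≤ μ) (hQ : Fintype.card r₁ ≤ μ)
    {κ : Type*} [Fintype κ] (r s : κ → Type*) [∀ i, Fintype (r i)] [∀ i, Fintype (s i)]
    (A : ∀ i, Matrix a (r i) K) (L : ∀ i, (σ → K) → Matrix (r i) (s i) K) (B : ∀ i, Matrix (s i) b K)
    (h : ∀ i, (∃ A' : Matrix r₀ (r i) K, A i = P * A') ∨ (∃ B' : Matrix (s i) r₁ K, B i = B' * Q))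
    (hC : ∀ y : σ → K,
      (Matrix.of fun i j => Matrix.mulVec H y (e.symm (i, j)).1) = ∑ i, A i * L i y * B i) :
    (H.submatrix (Subtype.val : {s : σ // grp s = t} → σ) id).rank ≤
      μ * (Fintype.card a + Fintype.card b) - μ * μ := by
  classical
  -- block coordinates as a linear equivalence
  let Ψ : ({s : σ // grp s = t} → K) ≃ₗ[K] Matrix a b K :=
    { toFun := fun v => Matrix.of fun i j => v (e.symm (i, j))
      invFun := fun M x => M (e x).1 (e x).2
      left_inv := fun v => by funext x; simp
      right_inv := fun M => by ext i j; simp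
      map_add' := fun v w => by ext i j; simp
      map_smul' := fun c v => by ext i j; simp }
  set Hb := H.submatrix (Subtype.val : {s : σ // grp s = t} → σ) id with hHb
  -- the reshaped slot map
  let C : (σ → K) →ₗ[K] Matrix a b K := Ψ.toLinearMap ∘ₗ Hb.mulVecLin
  have hCy : ∀ y, C y = ∑ i, A i * L i y * B i := by
    intro y
    rw [← hC y]
    ext i j
    simp [C, Ψ, hHb, Matrix.mulVec, dotProduct]
  have hrange : LinearMap.range C = (LinearMap.range Hb.mulVecLin).map Ψ.toLinearMap := by
    rw [LinearMap.range_comp]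
  have hrank : Hb.rank = finrank K ↥(LinearMap.range C) := by
    rw [hrange, LinearEquiv.finrank_map_eq]; rfl
  rw [hrank]
  exact finrank_range_le_slotRate_of_pivot μ ha hb P Q hP hQ r s A L B h C hCy

end Summit.ValiantsHypothesis.ValiantsHypothesis.Theorems.GrenetZeonTwoDimCoefficients.SlotAccounting
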